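import Summits.QuantumFields.BalabanUV.Beta.SpineRecursiveT2AllFinal
import Summits.QuantumFields.BalabanUV.Beta.SecondOrderBorderNoModel

/-!
# `BalabanUV.Beta.SpineRecursiveT2AllAntiTwin` — binder row D1, (L4): **hR FOR THE RECURSIVE WALL LITERAL WITH THE BORDER SOCKET IN ITS
# SATISFIABLE FORM** (owner NOTE X-an2-46 made constructive): the border table `vh₂S` is ANTI-TWIN (parity-even) with no `mm` block, and its
# letter is ONE exact `fm`-entrywise law at every level `j ≥ 0` — NO border residual at all; the `mf` block follows from the anti-twin
# parities (`SecondOrderBorderNoModel.conjW_canon_antiTwin`), the `mm` block is identically zero on both sides (β sub-cell, row BETA-an2 =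
# BINDER-OWNERS row D1 OWNER, lineage an2 gen 19)

HONEST FRAMING (cell charter, verbatim): «discharging BetaPertH makes Balaban's UV stability UNCONDITIONAL — a real
constructive-QFT result; it is NOT the continuum limit and NOT the Clay problem.»  DERIVED cell leaf (wiring, [folklore]); no statement of
Bałaban's papers, no `[cite:]`, no `def`, no `Prop` fact.  EVERY LETTER IS STILL A HYPOTHESIS; the file instantiates no binder of the wall by
itself.  NOT D1, NOT `BetaPertH`, NOT continuum, NOT Clay.

**`axisReflectionCovariant_flipK_TbalOf_JsRecWAtOf_of_letters_antiTwin`**: `∀ j, AxisReflectionCovariant (flipK (TbalOf Lc (JsRecWAtOf …) j))`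
from EXACTLY: (hWff)+RW-classes [an3: discharged at `T := (8N²)⁻¹•wsym22 N`, `RW := 0`, see `SpineRecursiveT2AllWilson`]; (hBat)/(hBmm0)/(hBe)
THE BORDER LETTER for an anti-twin border table — `((cB·wB2 j) • vh₂S κ (bref) κ′ (bref)) =fm= (εε) • refK ((cB·wB2 j) • vh₂S κ u κ′ u′ +
conjW 𝕄_j (S_j κ u) (S_j κ′ u′) (diagK γ_jĝ) (diagK γ_jĝ′) (diagK γ_j²ĝĝ′))`, NO residual [an1's (W-0B) after X-an2-46]; (hM2)+RM-classes [an1];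
lock2; table data.  A twin part of the true border jet, if kept, would only feed an odd residual (`…_of_letters_final`'s `RB` slot) and is
tadpole-null; this file is the `RB := 0` reading.
Provenance: β sub-cell, unit beta-an2 gen 19, 2026-08-20 (v1); no existing file touched.
-/

open Finset
open scoped BigOperators
open Literature.MathematicalPhysics.QuantumFieldTheory
open Literature.MathematicalPhysics.QuantumFieldTheory.Balaban1983to89
open Literature.MathematicalPhysics.QuantumFieldTheory.Balaban1983to89.Beta
open ExpKernelCalculus (MKer Decays BiLoc comp tadpole VertexFamily VertexFamily₂ shiftK)
open AffineAveraging (box toSite)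
open AveragingContoursRooted (ctr ctrOff ctrOff_mem_box)
open AveragingHessianKernels (packVH_inr_inr)
open AveragingHessianKernelsRooted (vhSAt)
open PolarizationSign (reflSign AxisReflectionCovariant)
open KernelReflection (refK refK_apply)
open ResolventReflection (bref Φ)
open OneStepResolventKernel (Fib LocStencil JetData wsum)
open OneStepKernelFamily (KInvStep colH vertexOfK TbalOf flipK)
open StepJetData (wilsonA)
open WilsonBiStencil (wilsonW₂)
open HessKerRate (biLoc_zero)
open BalabanStepJetsSucc (wE wVH mmRead)
open BalabanCompositeJets (LocStencil₂)
open BalabanStepW2 (M2Of wV4 wB2)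
open SecondOrderResponse (dM W2OfK W2SymOfK LocStencilFM vertex2OfK mixOfK K2OfK)
open Summit.QuantumFields.BalabanUV.Beta.TameKernelCalculus
open Summit.QuantumFields.BalabanUV.Beta.ChartConjugation (conjV conjW)
open Summit.QuantumFields.BalabanUV.Beta.AxialDressingRooted (coDressKBmAt)
open Summit.QuantumFields.BalabanUV.Beta.BorderedHessian (diagK ctGen bhKStepAt bhKStepAt_zero bhKStepAt_succ_mm bhKAt_inr_inr stepScale sgnK)
open Summit.QuantumFields.BalabanUV.Beta.WardLocusCubic (mmSym)
open Summit.QuantumFields.BalabanUV.Beta.SpineRecursiveParity (parityOdd_zero)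
open Summit.QuantumFields.BalabanUV.Beta.SpineRecursivePureParity (trK_SpureRecAt)
open Summit.QuantumFields.BalabanUV.Beta.BorderedHessianStepParity (trK_bhKStepAt)
open Summit.QuantumFields.BalabanUV.Beta.SecondOrderStepLaw (conjW_diag_apply)
open Summit.QuantumFields.BalabanUV.Beta.SecondOrderBorderParity (twin_of_parityOdd)
open Summit.QuantumFields.BalabanUV.Beta.SecondOrderBorderNoModel (antiTwin_of_parityEven conjW_canon_antiTwin)
open Summit.QuantumFields.BalabanUV.Beta.WilsonReflectionContact (wilsonA_inr_inr)

noncomputable section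

namespace Summit.QuantumFields.BalabanUV.Beta.SpineRooted

section Wall

variable {Lc : ℕ} [NeZero Lc]

/-- [folklore] Every unfolded first-order table `SpureRecAt … j κ u` has NO multiplier–multiplier block (any `d`, root, coefficients). -/
theorem SpureRecAt_inr_inr {d : ℕ} (ρ : Fin (d + 1) → ℤ) (cE cVH cΛ : ℝ) :
    ∀ (j : ℕ) (κ : Fin (d + 1)) (u x z : Fin (d + 1) → ℤ) (m m' : Fin (d + 1)),
      SpureRecAt d Lc ρ cE cVH cΛ j κ u x z (Sum.inr m) (Sum.inr m') = 0
  | 0, κ, u, x, z, m, m' => by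
    simp only [SpureRecAt_zero_level, Pi.add_apply, Pi.smul_apply, smul_eq_mul, wilsonA_inr_inr, AveragingHessianKernelsRooted.vhSAt,
      packVH_inr_inr, mul_zero, add_zero]
  | j + 1, κ, u, x, z, m, m' => by
    simp only [SpureRecAt_succ, Pi.add_apply, Pi.smul_apply, smul_eq_mul, e3OfK_inr_inr, AveragingHessianKernelsRooted.vhSAt, packVH_inr_inr,
      mul_zero, add_zero]

/-- [folklore] Every step bordered Hessian `bhKStepAt d ρ Lc j` has NO multiplier–multiplier block. -/
theorem bhKStepAt_inr_inr {d : ℕ} (ρ : Fin (d + 1) → ℤ) :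
    ∀ (j : ℕ) (x z : Fin (d + 1) → ℤ) (m m' : Fin (d + 1)), bhKStepAt d ρ Lc j x z (Sum.inr m) (Sum.inr m') = 0
  | 0, x, z, m, m' => by rw [bhKStepAt_zero, bhKAt_inr_inr]
  | j + 1, x, z, m, m' => bhKStepAt_succ_mm j x z m m'

/-- [folklore] **hR(v2.26, W := `WrecAt`) ⟸ THE LETTERS WITH THE BORDER SOCKET IN ITS SATISFIABLE (ANTI-TWIN, RESIDUAL-FREE) FORM**
(see the module docstring). -/
theorem axisReflectionCovariant_flipK_TbalOf_JsRecWAtOf_of_letters_antiTwin (hLc : Odd Lc) (cΛ cE₂ cB : ℝ) (T : Fin 4 → Fin 4 → Fin 4 → Fin 4 → ℝ)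
    {vh₂S : Fin 4 → (Fin 4 → ℤ) → Fin 4 → (Fin 4 → ℤ) → MKer 4 (Fib 3)} (hB : ∃ C δ : ℝ, 0 < δ ∧ LocStencil₂ vh₂S C δ)
    (hB0 : ∀ κ u κ' u' (x z : Fin 4 → ℤ) (β β' : Fin 4), vh₂S κ u κ' u' x z (Sum.inl β) (Sum.inl β') = 0)
    {mixFF : Fin 4 → (Fin 4 → ℤ) → Fin 4 → (Fin 4 → ℤ) → MKer 4 (Fib 3)} (hmix : ∃ C δ : ℝ, 0 < δ ∧ LocStencilFM Lc mixFF C δ)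
    (γ : ℕ → ℝ) (hγ : ∀ j, γ j = -((Lc : ℝ) ^ 8 / 2) * wVH 3 Lc j / (stepScale 3 Lc j * (Lc : ℝ) ^ 4))
    (hlock2 : ∀ j, cE₂ * wV4 3 Lc (j + 1) * wVH 3 Lc (j + 1) = ((Lc : ℝ) ^ 4 * wE 3 Lc (j + 1)) ^ 2)
    (RM : ℕ → Fin 4 → Fin 4 → (Fin 4 → ℤ) → Fin 4 → (Fin 4 → ℤ) → MKer 4 (Fib 3))
    (RW : Fin 4 → Fin 4 → (Fin 4 → ℤ) → Fin 4 → (Fin 4 → ℤ) → MKer 4 (Fib 3))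
    -- (hWff) THE WILSON (2,2) LETTER AT LEVEL 0, PARAMETER-FREE UP TO AN ODD FIELD-SUPPORTED SLOT `RW`
    (hWff : ∀ (α κ : Fin 4) (u : Fin 4 → ℤ) (κ' : Fin 4) (u' : Fin 4 → ℤ) (x z : Fin 4 → ℤ) (β β' : Fin 4),
      wilsonW₂ 3 T κ (bref α κ u) κ' (bref α κ' u') x z (Sum.inl β) (Sum.inl β') =
        ((reflSign α κ * reflSign α κ') • refK (Φ Lc α)
          (wilsonW₂ 3 T κ u κ' u' +
            conjW (bhKStepAt 3 (toSite (ctrOff 4 Lc)) Lc 0) (wilsonA 3 κ u) (wilsonA 3 κ' u')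
              (diagK fun p c => (-(1 / 2 : ℝ)) * ctGen 3 α Lc κ u p c) (diagK fun p c => (-(1 / 2 : ℝ)) * ctGen 3 α Lc κ' u' p c)
              (diagK fun p c => (-(1 / 2 : ℝ)) ^ 2 * (ctGen 3 α Lc κ u p c * ctGen 3 α Lc κ' u' p c)) + RW α κ u κ' u')) x z (Sum.inl β) (Sum.inl β'))
    (hRWl : ∀ α κ u κ' u' (x z : Fin 4 → ℤ) (m : Fin 4) (b' : Fib 3), RW α κ u κ' u' x z (Sum.inr m) b' = 0)
    (hRWr : ∀ α κ u κ' u' (x z : Fin 4 → ℤ) (a' : Fib 3) (m : Fin 4), RW α κ u κ' u' x z a' (Sum.inr m) = 0)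
    (hRWc : ∀ α : Fin 4, ∃ C δ : ℝ, 0 < δ ∧ LocStencil₂ (RW α) C δ)
    (hRWp : ∀ (α : Fin 4) κ u κ' u', trK (RW α κ u κ' u') = -sgnK (RW α κ u κ' u'))
    -- (hM2) THE MIXED LETTER ∀ j
    (hM2 : ∀ (j : ℕ) (α κ : Fin 4) (u : Fin 4 → ℤ) (ρ : Fin 4) (w : Fin 4 → ℤ),
      M2Of 3 Lc mixFF j κ (bref α κ u) ρ (bref α ρ w) =
        (reflSign α κ * reflSign α ρ) • refK (Φ Lc α)
          (M2Of 3 Lc mixFF j κ u ρ w + conjV (M1At 3 Lc (toSite (ctrOff 4 Lc)) cΛ j ρ w) (diagK fun p c => γ j * ctGen 3 α Lc κ u p c) +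
            RM j α κ u ρ w))
    (hRMc : ∀ (j : ℕ) (α : Fin 4), ∃ C δ : ℝ, 0 < δ ∧ LocStencilFM Lc (RM j α) C δ)
    (hRMp : ∀ (j : ℕ) (α : Fin 4) κ u ρ w, trK (RM j α κ u ρ w) = -sgnK (RM j α κ u ρ w))
    -- THE BORDER TABLE IS ANTI-TWIN (parity-even) WITH NO mm BLOCK, AND ITS LETTER IS ONE EXACT fm-LAW ∀ j ≥ 0 (X-an2-46)
    (hBat : ∀ κ u κ' u' (x z : Fin 4 → ℤ) (β m : Fin 4), vh₂S κ u κ' u' z x (Sum.inr m) (Sum.inl β) = -vh₂S κ u κ' u' x z (Sum.inl β) (Sum.inr m))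
    (hBmm0 : ∀ κ u κ' u' (x z : Fin 4 → ℤ) (m m' : Fin 4), vh₂S κ u κ' u' x z (Sum.inr m) (Sum.inr m') = 0)
    (hBe : ∀ (j : ℕ) (α : Fin 4) κ u κ' u' (x z : Fin 4 → ℤ) (β m : Fin 4),
      ((cB * wB2 3 Lc j) • vh₂S κ (bref α κ u) κ' (bref α κ' u')) x z (Sum.inl β) (Sum.inr m) =
        ((reflSign α κ * reflSign α κ') • refK (Φ Lc α) ((cB * wB2 3 Lc j) • vh₂S κ u κ' u' +
          conjW (bhKStepAt 3 (toSite (ctrOff 4 Lc)) Lc j)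
            (SpureRecAt 3 Lc (toSite (ctrOff 4 Lc)) ((Lc : ℝ) ^ 4) (-((Lc : ℝ) ^ 8 / 2)) cΛ j κ u)
            (SpureRecAt 3 Lc (toSite (ctrOff 4 Lc)) ((Lc : ℝ) ^ 4) (-((Lc : ℝ) ^ 8 / 2)) cΛ j κ' u')
            (diagK fun p c => γ j * ctGen 3 α Lc κ u p c) (diagK fun p c => γ j * ctGen 3 α Lc κ' u' p c)
            (diagK fun p c => γ j ^ 2 * (ctGen 3 α Lc κ u p c * ctGen 3 α Lc κ' u' p c)))) x z (Sum.inl β) (Sum.inr m))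
    (hBt : ∀ (κ : Fin 4) (u : Fin 4 → ℤ) (κ' : Fin 4) (u' t : Fin 4 → ℤ),
      vh₂S κ (u + (Lc : ℤ) • t) κ' (u' + (Lc : ℤ) • t) = shiftK (-((Lc : ℤ) • t)) (vh₂S κ u κ' u'))
    (hmixt : ∀ (κ : Fin 4) (u : Fin 4 → ℤ) (μ : Fin 4) (w t : Fin 4 → ℤ),
      mixFF κ (u + (Lc : ℤ) • t) μ (w + t) = shiftK (-((Lc : ℤ) • t)) (mixFF κ u μ w))
    :
    ∀ j : ℕ, AxisReflectionCovariant
      (flipK (TbalOf Lc (JsRecWAtOf (d := 3) hLc.pos (ctrOff_mem_box hLc.pos) ((Lc : ℝ) ^ 4) (-((Lc : ℝ) ^ 8 / 2)) cΛ cE₂ cB T hB hmix) j)) := by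
  have hL1 : 1 ≤ Lc := hLc.pos
  have hr := ctrOff_mem_box (d := 4) hL1
  -- parities of the wall's letters on the border blocks
  have hSt : ∀ (j : ℕ) (κ : Fin 4) (u x z : Fin 4 → ℤ) (β m : Fin 4),
      SpureRecAt 3 Lc (toSite (ctrOff 4 Lc)) ((Lc : ℝ) ^ 4) (-((Lc : ℝ) ^ 8 / 2)) cΛ j κ u z x (Sum.inr m) (Sum.inl β) =
        SpureRecAt 3 Lc (toSite (ctrOff 4 Lc)) ((Lc : ℝ) ^ 4) (-((Lc : ℝ) ^ 8 / 2)) cΛ j κ u x z (Sum.inl β) (Sum.inr m) :=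
    fun j κ u x z β m => twin_of_parityOdd (trK_SpureRecAt hL1 hr _ _ _ j κ u) x z β m
  have hMa : ∀ (j : ℕ) (x z : Fin 4 → ℤ) (β m : Fin 4),
      bhKStepAt 3 (toSite (ctrOff 4 Lc)) Lc j z x (Sum.inr m) (Sum.inl β) = -bhKStepAt 3 (toSite (ctrOff 4 Lc)) Lc j x z (Sum.inl β) (Sum.inr m) :=
    fun j x z β m => antiTwin_of_parityEven (trK_bhKStepAt (toSite (ctrOff 4 Lc)) Lc j) x z β m
  refine axisReflectionCovariant_flipK_TbalOf_JsRecWAtOf_of_letters_final hLc cΛ cE₂ cB T hB hB0 hmix γ hγ hlock2 RM RW (fun _ _ _ _ _ _ => 0) hWff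
    hRWl hRWr hRWc hRWp hM2 hRMc hRMp (fun _ _ _ _ _ _ _ _ _ _ => rfl)
    (fun _ _ => ⟨0, 1, one_pos, fun κ u κ' u' => by simpa using (biLoc_zero u u (1 : ℝ) : BiLoc (0 : MKer 4 (Fib 3)) u u 0 1)⟩)
    (fun _ _ _ _ _ _ => parityOdd_zero) ?_ ?_ ?_ hBt hmixt
  · -- fm: the exact law, `RB := 0`
    intro j α κ u κ' u' x z β m
    simpa only [add_zero] using hBe j α κ u κ' u' x z β m
  · -- mf: from the fm law at the transposed entry, by the anti-twin parities of BOTH sides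
    intro j α κ u κ' u' x z m β
    have e := hBe j α κ u κ' u' z x β m
    have aC := conjW_canon_antiTwin (𝕄 := bhKStepAt 3 (toSite (ctrOff 4 Lc)) Lc j)
      (S := SpureRecAt 3 Lc (toSite (ctrOff 4 Lc)) ((Lc : ℝ) ^ 4) (-((Lc : ℝ) ^ 8 / 2)) cΛ j κ u)
      (S' := SpureRecAt 3 Lc (toSite (ctrOff 4 Lc)) ((Lc : ℝ) ^ 4) (-((Lc : ℝ) ^ 8 / 2)) cΛ j κ' u')
      (g := fun p c => γ j * ctGen 3 α Lc κ u p c) (g' := fun p c => γ j * ctGen 3 α Lc κ' u' p c) (hSt j κ u) (hSt j κ' u') (hMa j)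
    have hcan : (diagK fun p c => γ j ^ 2 * (ctGen 3 α Lc κ u p c * ctGen 3 α Lc κ' u' p c)) =
        diagK fun p a => (γ j * ctGen 3 α Lc κ u p a) * (γ j * ctGen 3 α Lc κ' u' p a) := by
      congr 1; funext p a; ring
    rw [hcan] at e ⊢
    simp only [Pi.smul_apply, Pi.add_apply, add_zero, smul_eq_mul, refK_apply] at e ⊢
    rw [hBat κ (bref α κ u) κ' (bref α κ' u') z x β m, hBat κ u κ' u' _ _ β m, aC]
    linear_combination -e
  · -- mm: both sides vanish (no mm block in `vh₂S`, `SpureRecAt j`, `bhKStepAt j`)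
    intro j α κ u κ' u' x z m m'
    simp only [Pi.smul_apply, Pi.add_apply, smul_eq_mul, refK_apply, hBmm0, conjW_diag_apply, SpureRecAt_inr_inr,
      bhKStepAt_inr_inr, mul_zero, zero_mul, add_zero]

end Wall

end Summit.QuantumFields.BalabanUV.Beta.SpineRooted

end
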